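import Literature.MathematicalPhysics.StatisticalMechanics.SpecificRelativeEntropy
import Literature.Analysis.FunctionSpaces.PoissonPointProcessInvarianceProofs
import Literature.Analysis.FunctionSpaces.PoissonSuperpositionProofs
import Mathlib.InformationTheory.KullbackLeibler.Basic
import Mathlib.MeasureTheory.Measure.Prod
import HarnessLib

/-!
# Existence of the specific entropy relative to the free gas (Georgii–Zessin 1993): proofs

Topic `MathematicalPhysics/StatisticalMechanics`; namespace
`Literature.MathematicalPhysics.StatisticalMechanics`.  This file DISCHARGES the named fact
`Literature.MathematicalPhysics.StatisticalMechanics.GeorgiiZessin1993_specificEntropy` of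
`SpecificRelativeEntropy.lean` as `GeorgiiZessin1993_specificEntropy_holds`: for a finite mark
(velocity) measure `m` on `ℝ^d`, a Poisson process `π` with intensity `Leb ⊗ m` on phase-space
configurations and a translation-invariant law `ν`, the specific relative entropy
`lim_n H_{(-n,n)^d}(ν | π) / (2n)^d` exists (in `[0, ∞]`) and equals
`sup_C H_C(ν | π) / |C|` over all open cubes `C = ∏ᵢ (aᵢ, aᵢ + ℓ)` — Georgii–Zessin 1993, (2.12) and
Remark 2.5 (1), whose printed proof is "in the same way as the analogous results for lattice
systems, cf. [7]" (Georgii, *Gibbs Measures and Phase Transitions*, §15.1–15.2: superadditivity of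
the relative entropy in disjoint volumes with respect to a product reference, and the
multidimensional subadditivity lemma along cubes).  The proof below follows that architecture.

* Part I (measure theory, any measurable spaces).  `klDiv_map_eq_of_leftInvOn`: the
  Kullback–Leibler divergence of two image measures under a map with a measurable a.e. left inverse
  equals that of the measures (transport of the Radon–Nikodym density);
  `klDiv_map_fst_add_klDiv_map_snd_le`: for a probability `ρ` on `X × Y` and probabilities
  `α`, `β`, `KL(ρ₁ ‖ α) + KL(ρ₂ ‖ β) ≤ KL(ρ ‖ α ⊗ β)` (`ρᵢ` the marginals) — proved by densities
  (`f = dρ/d(α ⊗ β)`, `Fᵢ` its marginal densities, the pointwise identity `klFun_add_identity`,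
  Tonelli, and cancellation of the finite terms `∫ Fᵢ (log Fᵢ)⁻ ≤ 1` in `ℝ≥0∞`), so that no
  integrability case distinction and no disintegration is needed (Mathlib's chain rule
  `InformationTheory.klDiv_compProd_eq_add` would require a Markov-kernel disintegration of `ρ`,
  unavailable on the count σ-algebra of configurations).
* Part II (configurations, Poisson windows).  Restriction/superposition identities on
  `PointConfig`, measurability of `{c | c ⊆ W}`, and
  `IsPoissonPointProcess.map_restrict_prodMk_restrict`: for disjoint measurable `W₁, W₂` the joint
  law of `(c ∩ W₁, c ∩ W₂)` under a Poisson process with σ-finite intensity is the product of the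
  two laws — from the tree's discharged Restriction, Superposition and Uniqueness theorems
  (`IsPoissonPointProcess.restrict_holds`, `.superposition_holds`, `.unique_holds`).
* Part III (window entropies).  `windowRelEntropy_union_ge` (superadditivity over disjoint
  regions relative to the free gas), `windowRelEntropy_mono_set`, `sum_windowRelEntropy_le_biUnion`,
  translation invariance of the free gas (`IsPoissonPointProcess.isTranslationInvariant`, from
  `.map_translate_holds`) and of the window entropy (`windowRelEntropy_image_add`,
  `windowRelEntropy_box_add`).
* Part IV (cubes).  `k^d H_C ≤ H_{(-n,n)^d}` for `k ℓ ≤ 2n` by tiling the cube with `k^d` disjoint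
  translates of `C` (`pow_mul_windowRelEntropy_box_le_cube`), and `⌊2n/ℓ⌋/(2n) → 1/ℓ`.
* Part V.  `GeorgiiZessin1993_specificEntropy_holds`: `limsup ≤ sup` since the cubes `(-n, n)^d`
  are boxes of side `2n`, `sup ≤ liminf` by Part IV, hence the limit exists and equals both the
  `limsup` (`specificRelativeEntropy`) and the supremum.

The hypotheses `m ≠ 0` and `HasLocallyFiniteIntensity ν` of the named fact are not needed for this
part of Remark 2.5 (1) (they matter for finiteness and for the Palm-measure arguments of the
source) and are simply not used.  No definitions are introduced.  NOT here: affinity and lower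
semicontinuity of the specific entropy (Georgii–Zessin 1993 Remark 2.5 (2), Prop. 2.6), existence
relative to an interacting (Gibbsian) reference.

## References

* H.-O. Georgii, H. Zessin, *Large deviations and the maximum entropy principle for marked point
  random fields*, Probab. Theory Related Fields 96 (1993) 177–204: §2.1 (p. 180, configuration
  space, stationarity), §2.3 (p. 184: Poisson fields, (2.10)–(2.13), Remark 2.5). [GeorgiiZessin1993]
* H.-O. Georgii, *Gibbs Measures and Phase Transitions*, de Gruyter (1988, 2nd ed. 2011),
  §15.1–15.2 (relative entropy in sub-volumes, specific entropy via subadditivity). [Georgii2011]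
* J. F. C. Kingman, *Poisson Processes* (1993), §2.2 (Restriction, Superposition), §2.3 (Mapping).
  [Kingman1993]
-/

noncomputable section

open MeasureTheory Set Filter InformationTheory
open scoped ENNReal NNReal Topology
open Literature.Analysis.FunctionSpaces Literature.Analysis.FluidPDE

namespace Literature.MathematicalPhysics.StatisticalMechanics

/-! ## Part I — two lemmas on the Kullback–Leibler divergence -/

section KL

variable {X Y : Type*} [MeasurableSpace X] [MeasurableSpace Y]

/-- **Transport of the Kullback–Leibler divergence along an almost invertible map.**  If `g` has a
measurable left inverse `h` on a measurable set `A` carrying both finite measures `a` and `b`, then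
`KL(a ∘ g⁻¹ ‖ b ∘ g⁻¹) = KL(a ‖ b)`: the density of the image measures, pulled back along `g`, is a
density of `a` with respect to `b`. [folklore] -/
theorem klDiv_map_eq_of_leftInvOn {a b : Measure X} [IsFiniteMeasure a] [IsFiniteMeasure b]
    {g : X → Y} {h : Y → X} (hg : Measurable g) (hh : Measurable h) {A : Set X}
    (hA : MeasurableSet A) (haA : a Aᶜ = 0) (hbA : b Aᶜ = 0) (hinv : ∀ x ∈ A, h (g x) = x) :
    klDiv (a.map g) (b.map g) = klDiv a b := by
  -- `h ∘ g = id` almost everywhere, for both measures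
  have hback : ∀ μ : Measure X, μ Aᶜ = 0 → (μ.map g).map h = μ := fun μ hμ => by
    have hae : (h ∘ g) =ᵐ[μ] id := by
      filter_upwards [mem_ae_iff.2 hμ] with x hx using hinv x hx
    rw [Measure.map_map hh hg, Measure.map_congr hae, Measure.map_id]
  by_cases hab : a ≪ b
  swap
  · have hab' : ¬ a.map g ≪ b.map g := fun h' => hab (by
      have h'' := h'.map hh
      rwa [hback a haA, hback b hbA] at h'')
    rw [klDiv_of_not_ac hab, klDiv_of_not_ac hab']
  have hab' : a.map g ≪ b.map g := hab.map hg
  rw [klDiv_eq_lintegral_klFun_of_ac hab, klDiv_eq_lintegral_klFun_of_ac hab']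
  set ρ' := (a.map g).rnDeriv (b.map g) with hρ'
  have hρ'm : Measurable ρ' := Measure.measurable_rnDeriv _ _
  have hF : Measurable fun y => ENNReal.ofReal (klFun (ρ' y).toReal) :=
    (measurable_klFun.comp hρ'm.ennreal_toReal).ennreal_ofReal
  rw [lintegral_map hF hg]
  -- the sets `g ⁻¹' (h ⁻¹' (s ∩ A))` and `s` agree on `A`
  have hsets : ∀ {s : Set X} (μ : Measure X), μ Aᶜ = 0 →
      (g ⁻¹' (h ⁻¹' (s ∩ A)) : Set X) =ᵐ[μ] s := fun {s} μ hμ => by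
    refine Filter.eventuallyEq_set.2 ?_
    filter_upwards [mem_ae_iff.2 hμ] with x hx
    simp only [mem_preimage, mem_inter_iff, hinv x hx]
    exact ⟨fun h1 => h1.1, fun h1 => ⟨h1, hx⟩⟩
  -- `ρ' ∘ g` is a density of `a` with respect to `b`
  have hdens : b.withDensity (ρ' ∘ g) = a := by
    ext s hs
    have hBm : MeasurableSet (h ⁻¹' (s ∩ A)) := hh (hs.inter hA)
    calc b.withDensity (ρ' ∘ g) s
        = ∫⁻ x in s, ρ' (g x) ∂b := withDensity_apply _ hs
      _ = ∫⁻ x in g ⁻¹' (h ⁻¹' (s ∩ A)), ρ' (g x) ∂b := (setLIntegral_congr (hsets b hbA)).symm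
      _ = ∫⁻ y in h ⁻¹' (s ∩ A), ρ' y ∂(b.map g) := (setLIntegral_map hBm hρ'm hg).symm
      _ = (b.map g).withDensity ρ' (h ⁻¹' (s ∩ A)) := (withDensity_apply _ hBm).symm
      _ = a.map g (h ⁻¹' (s ∩ A)) := by rw [hρ', Measure.withDensity_rnDeriv_eq _ _ hab']
      _ = a (g ⁻¹' (h ⁻¹' (s ∩ A))) := Measure.map_apply hg hBm
      _ = a s := measure_congr (hsets a haA)
  have hrn : a.rnDeriv b =ᵐ[b] ρ' ∘ g := by
    have h1 := Measure.rnDeriv_withDensity b (hρ'm.comp hg)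
    rwa [hdens] at h1
  refine lintegral_congr_ae ?_
  filter_upwards [hrn] with x hx
  rw [hx]
  rfl

/-- The Kullback–Leibler divergence is invariant under a measurable bijection with measurable
inverse (given as a pair of mutually inverse measurable maps). [folklore] -/
theorem klDiv_map_eq_of_leftInverse {a b : Measure X} [IsFiniteMeasure a] [IsFiniteMeasure b]
    {g : X → Y} {h : Y → X} (hg : Measurable g) (hh : Measurable h)
    (hinv : Function.LeftInverse h g) :
    klDiv (a.map g) (b.map g) = klDiv a b :=
  klDiv_map_eq_of_leftInvOn hg hh MeasurableSet.univ (by simp) (by simp) fun x _ => hinv x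

/-! ### Superadditivity of the relative entropy with respect to a product reference -/

/-- Pointwise identity behind the superadditivity of relative entropy: for reals `t, u, v` with
`t = 0` whenever `uv = 0`,
`φ(t) + t (log u)⁻ + t (log v)⁻ + uv = uv φ(t / uv) + t (log u)⁺ + t (log v)⁺ + 1`,
`φ(t) = t log t + 1 - t`. [folklore] -/
theorem klFun_add_identity {t u v : ℝ} (h0 : u * v = 0 → t = 0) :
    klFun t + t * max (-Real.log u) 0 + t * max (-Real.log v) 0 + u * v =
      u * v * klFun (t / (u * v)) + t * max (Real.log u) 0 + t * max (Real.log v) 0 + 1 := by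
  have hlu := max_zero_sub_max_neg_zero_eq_self (Real.log u)
  have hlv := max_zero_sub_max_neg_zero_eq_self (Real.log v)
  by_cases hs : u * v = 0
  · have ht := h0 hs
    subst ht
    simp [hs, klFun_zero]
  · have hu : u ≠ 0 := fun h => hs (by simp [h])
    have hv : v ≠ 0 := fun h => hs (by simp [h])
    simp only [klFun_apply]
    by_cases ht : t = 0
    · subst ht
      simp only [zero_mul, Real.log_zero, zero_add, sub_zero, zero_div, mul_one, add_zero]
      ring
    · have hdiv : u * v * (t / (u * v)) = t := by field_simp
      rw [Real.log_div ht hs, Real.log_mul hu hv]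
      linear_combination t * hlu.symm + t * hlv.symm -
        (Real.log t - Real.log u - Real.log v - 1) * hdiv

/-- `φ(u) + u (log u)⁻ + u = u (log u)⁺ + 1` for `φ(u) = u log u + 1 - u`. [folklore] -/
theorem klFun_add_identity_marginal (u : ℝ) :
    klFun u + u * max (-Real.log u) 0 + u = u * max (Real.log u) 0 + 1 := by
  rw [klFun_apply]
  linear_combination (-u) * max_zero_sub_max_neg_zero_eq_self (Real.log u)

/-- `u (log u)⁻ ≤ 1` for `u ≥ 0` (indeed `-u log u ≤ 1 - u` on `(0, 1]`). [folklore] -/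
theorem mul_max_neg_log_le_one {u : ℝ} (hu : 0 ≤ u) : u * max (-Real.log u) 0 ≤ 1 := by
  rcases hu.eq_or_lt with rfl | hu'
  · simp
  rcases le_or_gt 0 (Real.log u) with hl | hl
  · rw [max_eq_right (neg_nonpos.2 hl), mul_zero]
    exact zero_le_one
  · rw [max_eq_left (neg_nonneg.2 hl.le)]
    have h1 := Real.one_sub_inv_le_log_of_pos hu'
    have h2 : u * (1 - u⁻¹) = u - 1 := by field_simp
    nlinarith [mul_le_mul_of_nonneg_left h1 hu]

/-- The `ℝ≥0∞` form of `klFun_add_identity_marginal` at a finite value `F` of a density, with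
`G = (log F)⁻`, `H = (log F)⁺` packaged as `ENNReal.ofReal`. [folklore] -/
theorem ennreal_klFun_add_identity_marginal {F : ℝ≥0∞} (hF : F ≠ ∞) :
    ENNReal.ofReal (klFun F.toReal) + F * ENNReal.ofReal (max (-Real.log F.toReal) 0) + F =
      F * ENNReal.ofReal (max (Real.log F.toReal) 0) + 1 := by
  have hu : 0 ≤ F.toReal := ENNReal.toReal_nonneg
  have hid := klFun_add_identity_marginal F.toReal
  have e1 : F = ENNReal.ofReal F.toReal := (ENNReal.ofReal_toReal hF).symm
  have hm : 0 ≤ F.toReal * max (-Real.log F.toReal) 0 := mul_nonneg hu (le_max_right _ _)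
  have hp : 0 ≤ F.toReal * max (Real.log F.toReal) 0 := mul_nonneg hu (le_max_right _ _)
  calc ENNReal.ofReal (klFun F.toReal) + F * ENNReal.ofReal (max (-Real.log F.toReal) 0) + F
      = ENNReal.ofReal (klFun F.toReal) +
          ENNReal.ofReal F.toReal * ENNReal.ofReal (max (-Real.log F.toReal) 0) +
          ENNReal.ofReal F.toReal := by rw [← e1]
    _ = ENNReal.ofReal (klFun F.toReal + F.toReal * max (-Real.log F.toReal) 0 + F.toReal) := by
        rw [ENNReal.ofReal_add (add_nonneg (klFun_nonneg hu) hm) hu,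
          ENNReal.ofReal_add (klFun_nonneg hu) hm, ENNReal.ofReal_mul hu]
    _ = ENNReal.ofReal (F.toReal * max (Real.log F.toReal) 0 + 1) := by rw [hid]
    _ = ENNReal.ofReal F.toReal * ENNReal.ofReal (max (Real.log F.toReal) 0) + 1 := by
        rw [ENNReal.ofReal_add hp zero_le_one, ENNReal.ofReal_mul hu, ENNReal.ofReal_one]
    _ = F * ENNReal.ofReal (max (Real.log F.toReal) 0) + 1 := by rw [← e1]

/-- **Superadditivity of the relative entropy with respect to a product reference measure.**  For a
probability measure `ρ` on `X × Y` with marginals `ρ₁`, `ρ₂` and probability measures `α`, `β`: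
`KL(ρ₁ ‖ α) + KL(ρ₂ ‖ β) ≤ KL(ρ ‖ α ⊗ β)`.  (The difference is the relative entropy of `ρ` with
respect to the product of its marginals; this is the inequality behind the superadditivity of the
entropy in disjoint volumes for a product reference state, Georgii, *Gibbs Measures and Phase
Transitions*, §15.1, and Georgii–Zessin 1993 Remark 2.5 (1).)  Proof by densities: with
`f = dρ/d(α ⊗ β)`, `F₁ = ∫ f dβ`, `F₂ = ∫ f dα` the pointwise identity `klFun_add_identity` is
integrated by Tonelli and the finite terms are cancelled in `ℝ≥0∞`. [folklore] -/
theorem klDiv_map_fst_add_klDiv_map_snd_le (ρ : Measure (X × Y)) [IsProbabilityMeasure ρ]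
    (α : Measure X) (β : Measure Y) [IsProbabilityMeasure α] [IsProbabilityMeasure β] :
    klDiv (ρ.map Prod.fst) α + klDiv (ρ.map Prod.snd) β ≤ klDiv ρ (α.prod β) := by
  by_cases hac : ρ ≪ α.prod β
  swap
  · rw [klDiv_of_not_ac hac]
    exact le_top
  /- densities -/
  set f := ρ.rnDeriv (α.prod β) with hf
  have hfm : Measurable f := Measure.measurable_rnDeriv _ _
  have hρ : (α.prod β).withDensity f = ρ := Measure.withDensity_rnDeriv_eq _ _ hac
  set F₁ : X → ℝ≥0∞ := fun x => ∫⁻ y, f (x, y) ∂β with hF₁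
  set F₂ : Y → ℝ≥0∞ := fun y => ∫⁻ x, f (x, y) ∂α with hF₂
  have hF₁m : Measurable F₁ := hfm.lintegral_prod_right'
  have hF₂m : Measurable F₂ := hfm.lintegral_prod_left'
  have hfm2 : ∀ μ : Measure (X × Y), AEMeasurable (Function.uncurry fun x y => f (x, y)) μ :=
    fun μ => hfm.aemeasurable
  /- the marginals have densities `F₁`, `F₂` -/
  have hρ₁ : ρ.map Prod.fst = α.withDensity F₁ := by
    ext s hs
    rw [Measure.map_apply measurable_fst hs, withDensity_apply _ hs, ← hρ,
      withDensity_apply _ (measurable_fst hs), ← prod_univ, setLIntegral_prod _ hfm.aemeasurable]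
    simp only [Measure.restrict_univ, hF₁]
  have hρ₂ : ρ.map Prod.snd = β.withDensity F₂ := by
    ext s hs
    rw [Measure.map_apply measurable_snd hs, withDensity_apply _ hs, ← hρ,
      withDensity_apply _ (measurable_snd hs), ← univ_prod, setLIntegral_prod _ hfm.aemeasurable,
      Measure.restrict_univ, lintegral_lintegral_swap (hfm2 _)]
  have hac₁ : ρ.map Prod.fst ≪ α := hρ₁ ▸ withDensity_absolutelyContinuous _ _
  have hac₂ : ρ.map Prod.snd ≪ β := hρ₂ ▸ withDensity_absolutelyContinuous _ _
  have hrn₁ : (ρ.map Prod.fst).rnDeriv α =ᵐ[α] F₁ := hρ₁ ▸ Measure.rnDeriv_withDensity α hF₁m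
  have hrn₂ : (ρ.map Prod.snd).rnDeriv β =ᵐ[β] F₂ := hρ₂ ▸ Measure.rnDeriv_withDensity β hF₂m
  /- total masses -/
  have hf_int : ∫⁻ z, f z ∂(α.prod β) = 1 := by
    rw [← setLIntegral_univ, ← withDensity_apply _ MeasurableSet.univ, hρ, measure_univ]
  have hF₁_int : ∫⁻ x, F₁ x ∂α = 1 := by rw [← hf_int, lintegral_prod _ hfm.aemeasurable]
  have hF₂_int : ∫⁻ y, F₂ y ∂β = 1 := by
    rw [← hf_int, lintegral_prod _ hfm.aemeasurable, lintegral_lintegral_swap (hfm2 _)]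
  have hf_lt : ∀ᵐ z ∂(α.prod β), f z < ∞ := ae_lt_top hfm (by simp [hf_int])
  have hF₁_lt : ∀ᵐ x ∂α, F₁ x < ∞ := ae_lt_top hF₁m (by simp [hF₁_int])
  have hF₂_lt : ∀ᵐ y ∂β, F₂ y < ∞ := ae_lt_top hF₂m (by simp [hF₂_int])
  have hF₁_lt' : ∀ᵐ z ∂(α.prod β), F₁ z.1 < ∞ :=
    (Measure.quasiMeasurePreserving_fst (μ := α) (ν := β)).ae hF₁_lt
  have hF₂_lt' : ∀ᵐ z ∂(α.prod β), F₂ z.2 < ∞ :=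
    (Measure.quasiMeasurePreserving_snd (μ := α) (ν := β)).ae hF₂_lt
  /- `f` vanishes where a marginal density vanishes -/
  have hF₁_zero : ∀ᵐ z ∂(α.prod β), F₁ z.1 = 0 → f z = 0 := by
    have hS : MeasurableSet {x | F₁ x = 0} := hF₁m (measurableSet_singleton 0)
    have h0 : ∫⁻ z in Prod.fst ⁻¹' {x | F₁ x = 0}, f z ∂(α.prod β) = 0 := by
      rw [← prod_univ, setLIntegral_prod _ hfm.aemeasurable]
      simp only [Measure.restrict_univ]
      rw [setLIntegral_congr_fun hS (fun x hx => hx)]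
      simp
    have h1 := (lintegral_eq_zero_iff' hfm.aemeasurable.restrict).1 h0
    rw [Filter.EventuallyEq, ae_restrict_iff' (measurable_fst hS)] at h1
    filter_upwards [h1] with z hz using hz
  have hF₂_zero : ∀ᵐ z ∂(α.prod β), F₂ z.2 = 0 → f z = 0 := by
    have hS : MeasurableSet {y | F₂ y = 0} := hF₂m (measurableSet_singleton 0)
    have h0 : ∫⁻ z in Prod.snd ⁻¹' {y | F₂ y = 0}, f z ∂(α.prod β) = 0 := by
      rw [← univ_prod, setLIntegral_prod _ hfm.aemeasurable, Measure.restrict_univ,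
        lintegral_lintegral_swap (hfm2 _), setLIntegral_congr_fun hS (fun y hy => hy)]
      simp
    have h1 := (lintegral_eq_zero_iff' hfm.aemeasurable.restrict).1 h0
    rw [Filter.EventuallyEq, ae_restrict_iff' (measurable_snd hS)] at h1
    filter_upwards [h1] with z hz using hz
  /- the auxiliary integrands `G = (log F)⁻`, `H = (log F)⁺` -/
  set G₁ : X → ℝ≥0∞ := fun x => ENNReal.ofReal (max (-Real.log (F₁ x).toReal) 0) with hG₁
  set H₁ : X → ℝ≥0∞ := fun x => ENNReal.ofReal (max (Real.log (F₁ x).toReal) 0) with hH₁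
  set G₂ : Y → ℝ≥0∞ := fun y => ENNReal.ofReal (max (-Real.log (F₂ y).toReal) 0) with hG₂
  set H₂ : Y → ℝ≥0∞ := fun y => ENNReal.ofReal (max (Real.log (F₂ y).toReal) 0) with hH₂
  have hG₁m : Measurable G₁ :=
    ((Real.measurable_log.comp hF₁m.ennreal_toReal).neg.max measurable_const).ennreal_ofReal
  have hH₁m : Measurable H₁ :=
    ((Real.measurable_log.comp hF₁m.ennreal_toReal).max measurable_const).ennreal_ofReal
  have hG₂m : Measurable G₂ :=
    ((Real.measurable_log.comp hF₂m.ennreal_toReal).neg.max measurable_const).ennreal_ofReal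
  have hH₂m : Measurable H₂ :=
    ((Real.measurable_log.comp hF₂m.ennreal_toReal).max measurable_const).ennreal_ofReal
  -- the four marginal integrals (the `N`'s are finite)
  obtain ⟨N₁, hN₁⟩ : ∃ N : ℝ≥0∞, N = ∫⁻ x, F₁ x * G₁ x ∂α := ⟨_, rfl⟩
  obtain ⟨N₂, hN₂⟩ : ∃ N : ℝ≥0∞, N = ∫⁻ y, F₂ y * G₂ y ∂β := ⟨_, rfl⟩
  obtain ⟨P₁, hP₁⟩ : ∃ P : ℝ≥0∞, P = ∫⁻ x, F₁ x * H₁ x ∂α := ⟨_, rfl⟩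
  obtain ⟨P₂, hP₂⟩ : ∃ P : ℝ≥0∞, P = ∫⁻ y, F₂ y * H₂ y ∂β := ⟨_, rfl⟩
  have hN₁_le : N₁ ≤ 1 := by
    rw [hN₁]
    calc ∫⁻ x, F₁ x * G₁ x ∂α ≤ ∫⁻ _, 1 ∂α := by
          refine lintegral_mono_ae ?_
          filter_upwards [hF₁_lt] with x hx
          have e : F₁ x * G₁ x =
              ENNReal.ofReal ((F₁ x).toReal * max (-Real.log (F₁ x).toReal) 0) := by
            rw [ENNReal.ofReal_mul ENNReal.toReal_nonneg, ENNReal.ofReal_toReal hx.ne]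
          rw [e, ← ENNReal.ofReal_one]
          exact ENNReal.ofReal_le_ofReal (mul_max_neg_log_le_one ENNReal.toReal_nonneg)
      _ = 1 := by simp
  have hN₂_le : N₂ ≤ 1 := by
    rw [hN₂]
    calc ∫⁻ y, F₂ y * G₂ y ∂β ≤ ∫⁻ _, 1 ∂β := by
          refine lintegral_mono_ae ?_
          filter_upwards [hF₂_lt] with y hy
          have e : F₂ y * G₂ y =
              ENNReal.ofReal ((F₂ y).toReal * max (-Real.log (F₂ y).toReal) 0) := by
            rw [ENNReal.ofReal_mul ENNReal.toReal_nonneg, ENNReal.ofReal_toReal hy.ne]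
          rw [e, ← ENNReal.ofReal_one]
          exact ENNReal.ofReal_le_ofReal (mul_max_neg_log_le_one ENNReal.toReal_nonneg)
      _ = 1 := by simp
  have hN_ne : N₁ + N₂ + 1 ≠ ∞ := by
    refine ENNReal.add_ne_top.2 ⟨ENNReal.add_ne_top.2 ⟨?_, ?_⟩, ENNReal.one_ne_top⟩
    · exact ne_top_of_le_ne_top ENNReal.one_ne_top hN₁_le
    · exact ne_top_of_le_ne_top ENNReal.one_ne_top hN₂_le
  /- the marginal identities: `KL(ρ₁ ‖ α) + N₁ = P₁`, `KL(ρ₂ ‖ β) + N₂ = P₂` -/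
  have hmarg₁ : klDiv (ρ.map Prod.fst) α + N₁ = P₁ := by
    have mB : Measurable fun x => F₁ x * G₁ x := hF₁m.mul hG₁m
    have h1 : klDiv (ρ.map Prod.fst) α + N₁ + 1 = P₁ + 1 := by
      calc klDiv (ρ.map Prod.fst) α + N₁ + 1
          = ∫⁻ x, (ENNReal.ofReal (klFun (((ρ.map Prod.fst).rnDeriv α x).toReal)) +
              F₁ x * G₁ x + F₁ x) ∂α := by
            rw [lintegral_add_right _ hF₁m, lintegral_add_right _ mB,
              ← klDiv_eq_lintegral_klFun_of_ac hac₁, hF₁_int, hN₁]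
        _ = ∫⁻ x, (F₁ x * H₁ x + 1) ∂α := by
            refine lintegral_congr_ae ?_
            filter_upwards [hrn₁, hF₁_lt] with x hx hxlt
            rw [hx]
            exact ennreal_klFun_add_identity_marginal hxlt.ne
        _ = P₁ + 1 := by
            rw [lintegral_add_right _ measurable_const, lintegral_const, measure_univ, mul_one, hP₁]
    exact (ENNReal.add_left_inj ENNReal.one_ne_top).1 h1
  have hmarg₂ : klDiv (ρ.map Prod.snd) β + N₂ = P₂ := by
    have mB : Measurable fun y => F₂ y * G₂ y := hF₂m.mul hG₂m
    have h1 : klDiv (ρ.map Prod.snd) β + N₂ + 1 = P₂ + 1 := by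
      calc klDiv (ρ.map Prod.snd) β + N₂ + 1
          = ∫⁻ y, (ENNReal.ofReal (klFun (((ρ.map Prod.snd).rnDeriv β y).toReal)) +
              F₂ y * G₂ y + F₂ y) ∂β := by
            rw [lintegral_add_right _ hF₂m, lintegral_add_right _ mB,
              ← klDiv_eq_lintegral_klFun_of_ac hac₂, hF₂_int, hN₂]
        _ = ∫⁻ y, (F₂ y * H₂ y + 1) ∂β := by
            refine lintegral_congr_ae ?_
            filter_upwards [hrn₂, hF₂_lt] with y hy hylt
            rw [hy]
            exact ennreal_klFun_add_identity_marginal hylt.ne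
        _ = P₂ + 1 := by
            rw [lintegral_add_right _ measurable_const, lintegral_const, measure_univ, mul_one, hP₂]
    exact (ENNReal.add_left_inj ENNReal.one_ne_top).1 h1
  /- the joint identity: `KL(ρ ‖ α ⊗ β) + N₁ + N₂ + 1 = D + P₁ + P₂ + 1` -/
  obtain ⟨D, hD⟩ : ∃ D : ℝ≥0∞, D = ∫⁻ z, ENNReal.ofReal ((F₁ z.1).toReal * (F₂ z.2).toReal *
      klFun ((f z).toReal / ((F₁ z.1).toReal * (F₂ z.2).toReal))) ∂(α.prod β) := ⟨_, rfl⟩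
  -- every marginal term is an integral over `α ⊗ β`
  have eN₁ : N₁ = ∫⁻ z, ENNReal.ofReal ((f z).toReal * max (-Real.log (F₁ z.1).toReal) 0)
      ∂(α.prod β) := by
    rw [hN₁]
    symm
    calc ∫⁻ z, ENNReal.ofReal ((f z).toReal * max (-Real.log (F₁ z.1).toReal) 0) ∂(α.prod β)
        = ∫⁻ z, f z * G₁ z.1 ∂(α.prod β) := by
          refine lintegral_congr_ae ?_
          filter_upwards [hf_lt] with z hz
          rw [ENNReal.ofReal_mul ENNReal.toReal_nonneg, ENNReal.ofReal_toReal hz.ne]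
      _ = ∫⁻ x, ∫⁻ y, f (x, y) * G₁ x ∂β ∂α :=
          lintegral_prod (fun z => f z * G₁ z.1) (hfm.mul (hG₁m.comp measurable_fst)).aemeasurable
      _ = ∫⁻ x, F₁ x * G₁ x ∂α :=
          lintegral_congr fun x => lintegral_mul_const (G₁ x)
            (show Measurable (fun y => f (x, y)) from hfm.comp measurable_prodMk_left)
  have eP₁ : P₁ = ∫⁻ z, ENNReal.ofReal ((f z).toReal * max (Real.log (F₁ z.1).toReal) 0)
      ∂(α.prod β) := by
    rw [hP₁]
    symm
    calc ∫⁻ z, ENNReal.ofReal ((f z).toReal * max (Real.log (F₁ z.1).toReal) 0) ∂(α.prod β)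
        = ∫⁻ z, f z * H₁ z.1 ∂(α.prod β) := by
          refine lintegral_congr_ae ?_
          filter_upwards [hf_lt] with z hz
          rw [ENNReal.ofReal_mul ENNReal.toReal_nonneg, ENNReal.ofReal_toReal hz.ne]
      _ = ∫⁻ x, ∫⁻ y, f (x, y) * H₁ x ∂β ∂α :=
          lintegral_prod (fun z => f z * H₁ z.1) (hfm.mul (hH₁m.comp measurable_fst)).aemeasurable
      _ = ∫⁻ x, F₁ x * H₁ x ∂α :=
          lintegral_congr fun x => lintegral_mul_const (H₁ x)
            (show Measurable (fun y => f (x, y)) from hfm.comp measurable_prodMk_left)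
  have eN₂ : N₂ = ∫⁻ z, ENNReal.ofReal ((f z).toReal * max (-Real.log (F₂ z.2).toReal) 0)
      ∂(α.prod β) := by
    rw [hN₂]
    symm
    calc ∫⁻ z, ENNReal.ofReal ((f z).toReal * max (-Real.log (F₂ z.2).toReal) 0) ∂(α.prod β)
        = ∫⁻ z, f z * G₂ z.2 ∂(α.prod β) := by
          refine lintegral_congr_ae ?_
          filter_upwards [hf_lt] with z hz
          rw [ENNReal.ofReal_mul ENNReal.toReal_nonneg, ENNReal.ofReal_toReal hz.ne]
      _ = ∫⁻ y, ∫⁻ x, f (x, y) * G₂ y ∂α ∂β :=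
          lintegral_prod_symm (fun z => f z * G₂ z.2)
            (hfm.mul (hG₂m.comp measurable_snd)).aemeasurable
      _ = ∫⁻ y, F₂ y * G₂ y ∂β :=
          lintegral_congr fun y => lintegral_mul_const (G₂ y)
            (show Measurable (fun x => f (x, y)) from hfm.comp measurable_prodMk_right)
  have eP₂ : P₂ = ∫⁻ z, ENNReal.ofReal ((f z).toReal * max (Real.log (F₂ z.2).toReal) 0)
      ∂(α.prod β) := by
    rw [hP₂]
    symm
    calc ∫⁻ z, ENNReal.ofReal ((f z).toReal * max (Real.log (F₂ z.2).toReal) 0) ∂(α.prod β)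
        = ∫⁻ z, f z * H₂ z.2 ∂(α.prod β) := by
          refine lintegral_congr_ae ?_
          filter_upwards [hf_lt] with z hz
          rw [ENNReal.ofReal_mul ENNReal.toReal_nonneg, ENNReal.ofReal_toReal hz.ne]
      _ = ∫⁻ y, ∫⁻ x, f (x, y) * H₂ y ∂α ∂β :=
          lintegral_prod_symm (fun z => f z * H₂ z.2)
            (hfm.mul (hH₂m.comp measurable_snd)).aemeasurable
      _ = ∫⁻ y, F₂ y * H₂ y ∂β :=
          lintegral_congr fun y => lintegral_mul_const (H₂ y)
            (show Measurable (fun x => f (x, y)) from hfm.comp measurable_prodMk_right)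
  have eUV : (1 : ℝ≥0∞) = ∫⁻ z, ENNReal.ofReal ((F₁ z.1).toReal * (F₂ z.2).toReal)
      ∂(α.prod β) := by
    symm
    calc ∫⁻ z, ENNReal.ofReal ((F₁ z.1).toReal * (F₂ z.2).toReal) ∂(α.prod β)
        = ∫⁻ z, F₁ z.1 * F₂ z.2 ∂(α.prod β) := by
          refine lintegral_congr_ae ?_
          filter_upwards [hF₁_lt', hF₂_lt'] with z hz1 hz2
          rw [ENNReal.ofReal_mul ENNReal.toReal_nonneg, ENNReal.ofReal_toReal hz1.ne,
            ENNReal.ofReal_toReal hz2.ne]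
      _ = 1 := by
          rw [lintegral_prod_mul hF₁m.aemeasurable hF₂m.aemeasurable, hF₁_int, hF₂_int, one_mul]
  -- measurability of the eight integrands
  have hT : Measurable fun z : X × Y => (f z).toReal := hfm.ennreal_toReal
  have hU : Measurable fun z : X × Y => (F₁ z.1).toReal := (hF₁m.comp measurable_fst).ennreal_toReal
  have hV : Measurable fun z : X × Y => (F₂ z.2).toReal := (hF₂m.comp measurable_snd).ennreal_toReal
  have m2 : Measurable fun z : X × Y =>
      ENNReal.ofReal ((f z).toReal * max (-Real.log (F₁ z.1).toReal) 0) :=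
    (hT.mul ((Real.measurable_log.comp hU).neg.max measurable_const)).ennreal_ofReal
  have m3 : Measurable fun z : X × Y =>
      ENNReal.ofReal ((f z).toReal * max (-Real.log (F₂ z.2).toReal) 0) :=
    (hT.mul ((Real.measurable_log.comp hV).neg.max measurable_const)).ennreal_ofReal
  have m4 : Measurable fun z : X × Y => ENNReal.ofReal ((F₁ z.1).toReal * (F₂ z.2).toReal) :=
    (hU.mul hV).ennreal_ofReal
  have m6 : Measurable fun z : X × Y =>
      ENNReal.ofReal ((f z).toReal * max (Real.log (F₁ z.1).toReal) 0) :=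
    (hT.mul ((Real.measurable_log.comp hU).max measurable_const)).ennreal_ofReal
  have m7 : Measurable fun z : X × Y =>
      ENNReal.ofReal ((f z).toReal * max (Real.log (F₂ z.2).toReal) 0) :=
    (hT.mul ((Real.measurable_log.comp hV).max measurable_const)).ennreal_ofReal
  have hjoint : klDiv ρ (α.prod β) + N₁ + N₂ + 1 = D + P₁ + P₂ + 1 := by
    have lhs : klDiv ρ (α.prod β) + N₁ + N₂ + 1 =
        ∫⁻ z, (ENNReal.ofReal (klFun ((ρ.rnDeriv (α.prod β) z).toReal)) +
          ENNReal.ofReal ((f z).toReal * max (-Real.log (F₁ z.1).toReal) 0) +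
          ENNReal.ofReal ((f z).toReal * max (-Real.log (F₂ z.2).toReal) 0) +
          ENNReal.ofReal ((F₁ z.1).toReal * (F₂ z.2).toReal)) ∂(α.prod β) := by
      rw [lintegral_add_right _ m4, lintegral_add_right _ m3, lintegral_add_right _ m2,
        ← klDiv_eq_lintegral_klFun_of_ac hac, ← eN₁, ← eN₂, ← eUV]
    have rhs : D + P₁ + P₂ + 1 =
        ∫⁻ z, (ENNReal.ofReal ((F₁ z.1).toReal * (F₂ z.2).toReal *
            klFun ((f z).toReal / ((F₁ z.1).toReal * (F₂ z.2).toReal))) +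
          ENNReal.ofReal ((f z).toReal * max (Real.log (F₁ z.1).toReal) 0) +
          ENNReal.ofReal ((f z).toReal * max (Real.log (F₂ z.2).toReal) 0) + 1) ∂(α.prod β) := by
      rw [lintegral_add_right _ measurable_const, lintegral_add_right _ m7,
        lintegral_add_right _ m6, lintegral_const, measure_univ, mul_one, ← eP₁, ← eP₂, hD]
    rw [lhs, rhs]
    refine lintegral_congr_ae ?_
    filter_upwards [hF₁_lt', hF₂_lt', hF₁_zero, hF₂_zero] with z hz1 hz2 hz1' hz2'
    have ht0 : 0 ≤ (f z).toReal := ENNReal.toReal_nonneg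
    have hu0 : 0 ≤ (F₁ z.1).toReal := ENNReal.toReal_nonneg
    have hv0 : 0 ≤ (F₂ z.2).toReal := ENNReal.toReal_nonneg
    have himp : (F₁ z.1).toReal * (F₂ z.2).toReal = 0 → (f z).toReal = 0 := by
      intro huv
      rcases mul_eq_zero.1 huv with h | h
      · rw [ENNReal.toReal_eq_zero_iff] at h
        rcases h with h' | h'
        · simp [hz1' h']
        · exact absurd h' hz1.ne
      · rw [ENNReal.toReal_eq_zero_iff] at h
        rcases h with h' | h'
        · simp [hz2' h']
        · exact absurd h' hz2.ne
    have hid := klFun_add_identity himp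
    have n1 : 0 ≤ klFun (f z).toReal := klFun_nonneg ht0
    have n2 : 0 ≤ (f z).toReal * max (-Real.log (F₁ z.1).toReal) 0 :=
      mul_nonneg ht0 (le_max_right _ _)
    have n3 : 0 ≤ (f z).toReal * max (-Real.log (F₂ z.2).toReal) 0 :=
      mul_nonneg ht0 (le_max_right _ _)
    have n4 : 0 ≤ (F₁ z.1).toReal * (F₂ z.2).toReal := mul_nonneg hu0 hv0
    have n5 : 0 ≤ (F₁ z.1).toReal * (F₂ z.2).toReal *
        klFun ((f z).toReal / ((F₁ z.1).toReal * (F₂ z.2).toReal)) :=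
      mul_nonneg n4 (klFun_nonneg (div_nonneg ht0 n4))
    have n6 : 0 ≤ (f z).toReal * max (Real.log (F₁ z.1).toReal) 0 :=
      mul_nonneg ht0 (le_max_right _ _)
    have n7 : 0 ≤ (f z).toReal * max (Real.log (F₂ z.2).toReal) 0 :=
      mul_nonneg ht0 (le_max_right _ _)
    rw [← ENNReal.ofReal_add n1 n2, ← ENNReal.ofReal_add (add_nonneg n1 n2) n3,
      ← ENNReal.ofReal_add (add_nonneg (add_nonneg n1 n2) n3) n4, ← ENNReal.ofReal_one,
      ← ENNReal.ofReal_add n5 n6, ← ENNReal.ofReal_add (add_nonneg n5 n6) n7,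
      ← ENNReal.ofReal_add (add_nonneg (add_nonneg n5 n6) n7) zero_le_one, hid]
  /- conclusion: cancel the finite constants -/
  have hfinal : klDiv ρ (α.prod β) + (N₁ + N₂ + 1) =
      (D + klDiv (ρ.map Prod.fst) α + klDiv (ρ.map Prod.snd) β) + (N₁ + N₂ + 1) := by
    have e1 : klDiv ρ (α.prod β) + (N₁ + N₂ + 1) = klDiv ρ (α.prod β) + N₁ + N₂ + 1 := by ring
    rw [e1, hjoint, ← hmarg₁, ← hmarg₂]
    ring
  rw [ENNReal.add_left_inj hN_ne] at hfinal
  rw [hfinal, add_assoc]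
  exact le_add_self

end KL

/-! ## Part II — restriction and superposition of configurations; Poisson windows -/

section Config

variable {E : Type*} [TopologicalSpace E]

/-- Restricting twice is restricting to the intersection. [folklore] -/
theorem restrict_restrict_config (s t : Set E) (c : PointConfig E) :
    PointConfig.restrict t (PointConfig.restrict s c) = PointConfig.restrict (s ∩ t) c := by
  ext x
  change x ∈ (c.carrier ∩ s) ∩ t ↔ x ∈ c.carrier ∩ (s ∩ t)
  rw [inter_assoc]

/-- A configuration contained in `s` is its own restriction to `s`. [folklore] -/
theorem restrict_config_eq_self {s : Set E} {c : PointConfig E} (h : c.carrier ⊆ s) :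
    PointConfig.restrict s c = c := by
  ext x
  change x ∈ c.carrier ∩ s ↔ x ∈ c.carrier
  exact ⟨fun hx => hx.1, fun hx => ⟨hx, h hx⟩⟩

/-- A restricted configuration lies in the restricting set. [folklore] -/
theorem carrier_restrict_config_subset (s : Set E) (c : PointConfig E) :
    (PointConfig.restrict s c).carrier ⊆ s :=
  inter_subset_right

/-- The restrictions to two sets superpose to the restriction to the union. [folklore] -/
theorem restrict_union_restrict_config (s t : Set E) (c : PointConfig E) :
    PointConfig.restrict s c ∪ PointConfig.restrict t c = PointConfig.restrict (s ∪ t) c := by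
  ext x
  change x ∈ (c.carrier ∩ s) ∪ (c.carrier ∩ t) ↔ x ∈ c.carrier ∩ (s ∪ t)
  rw [inter_union_distrib_left]

/-- Restricting a superposition of configurations living in disjoint sets recovers the first
summand. [folklore] -/
theorem restrict_union_config_left {s t : Set E} (hst : Disjoint s t) {c d : PointConfig E}
    (hc : c.carrier ⊆ s) (hd : d.carrier ⊆ t) : PointConfig.restrict s (c ∪ d) = c := by
  ext x
  change x ∈ (c.carrier ∪ d.carrier) ∩ s ↔ x ∈ c.carrier
  refine ⟨fun hx => ?_, fun hx => ⟨Or.inl hx, hc hx⟩⟩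
  rcases hx.1 with h | h
  · exact h
  · exact absurd hx.2 (Set.disjoint_right.1 hst (hd h))

/-- Restricting a superposition of configurations living in disjoint sets recovers the second
summand. [folklore] -/
theorem restrict_union_config_right {s t : Set E} (hst : Disjoint s t) {c d : PointConfig E}
    (hc : c.carrier ⊆ s) (hd : d.carrier ⊆ t) : PointConfig.restrict t (c ∪ d) = d := by
  ext x
  change x ∈ (c.carrier ∪ d.carrier) ∩ t ↔ x ∈ d.carrier
  refine ⟨fun hx => ?_, fun hx => ⟨Or.inr hx, hd hx⟩⟩
  rcases hx.1 with h | h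
  · exact absurd hx.2 (Set.disjoint_left.1 hst (hc h))
  · exact h

variable [MeasurableSpace E]

/-- The set of configurations contained in a measurable set `s` is measurable (it is the event
`N(sᶜ) = 0`). [folklore] -/
theorem measurableSet_setOf_carrier_subset {s : Set E} (hs : MeasurableSet s) :
    MeasurableSet {c : PointConfig E | c.carrier ⊆ s} := by
  have h : {c : PointConfig E | c.carrier ⊆ s} = (fun c : PointConfig E => c.count sᶜ) ⁻¹' {0} := by
    ext c
    simp only [mem_setOf_eq, mem_preimage, mem_singleton_iff, PointConfig.count,
      Set.encard_eq_zero]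
    rw [← Set.disjoint_iff_inter_eq_empty, Set.disjoint_compl_right_iff_subset]
  rw [h]
  exact PointConfig.measurable_count hs.compl (measurableSet_singleton 0)

/-- Under the image of a law by restriction to `s`, almost every configuration lies in `s`.
[folklore] -/
theorem ae_map_restrict_carrier_subset {s : Set E} (hs : MeasurableSet s)
    (P : Measure (PointConfig E)) :
    ∀ᵐ c ∂(P.map (PointConfig.restrict s)), c.carrier ⊆ s := by
  rw [ae_map_iff (PointConfig.measurable_restrict hs).aemeasurable
    (measurableSet_setOf_carrier_subset hs)]
  exact ae_of_all _ fun c => carrier_restrict_config_subset s c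

end Config

section Poisson

variable {E : Type*} [TopologicalSpace E] [MeasurableSpace E] [T2Space E]
  [SecondCountableTopology E] [BorelSpace E]

/-- **Independence of a Poisson process over disjoint regions, as a product decomposition.**  If
`P` is a Poisson point process with σ-finite intensity and `W₁, W₂` are disjoint measurable sets,
the joint law of the two restricted configurations `(c ∩ W₁, c ∩ W₂)` is the product of their laws.
Obtained from Kingman's Restriction and Superposition Theorems and Rényi's uniqueness
(`IsPoissonPointProcess.restrict_holds`, `.superposition_holds`, `.unique_holds`): the
superposition of independent copies of the two restricted processes has the law of `c ∩ (W₁ ∪ W₂)`,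
and superposition is inverted by the pair of restrictions on configurations living in `W₁`, `W₂`.
(Kingman, *Poisson Processes* (1993), §2.2; Georgii–Zessin 1993 §2.3 "the product structure" of
`Q`.) [cite: Kingman1993, §2.2] -/
theorem _root_.Literature.Analysis.FunctionSpaces.IsPoissonPointProcess.map_restrict_prodMk_restrict
    {ι : Measure E} [SigmaFinite ι] {P : Measure (PointConfig E)} (hP : IsPoissonPointProcess ι P)
    {W₁ W₂ : Set E}
    (hW₁ : MeasurableSet W₁) (hW₂ : MeasurableSet W₂) (hd : Disjoint W₁ W₂) :
    P.map (fun c => (PointConfig.restrict W₁ c, PointConfig.restrict W₂ c)) =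
      (P.map (PointConfig.restrict W₁)).prod (P.map (PointConfig.restrict W₂)) := by
  haveI := hP.isProbabilityMeasure
  have hr₁ : Measurable (PointConfig.restrict W₁ : PointConfig E → PointConfig E) :=
    PointConfig.measurable_restrict hW₁
  have hr₂ : Measurable (PointConfig.restrict W₂ : PointConfig E → PointConfig E) :=
    PointConfig.measurable_restrict hW₂
  have hr₁₂ : Measurable (PointConfig.restrict (W₁ ∪ W₂) : PointConfig E → PointConfig E) :=
    PointConfig.measurable_restrict (hW₁.union hW₂)
  have hU : Measurable fun p : PointConfig E × PointConfig E => p.1 ∪ p.2 :=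
    PointConfig.measurable_union'
  have hT : Measurable fun c : PointConfig E =>
      (PointConfig.restrict W₁ c, PointConfig.restrict W₂ c) := hr₁.prodMk hr₂
  haveI : IsProbabilityMeasure (P.map (PointConfig.restrict W₁)) :=
    Measure.isProbabilityMeasure_map hr₁.aemeasurable
  haveI : IsProbabilityMeasure (P.map (PointConfig.restrict W₂)) :=
    Measure.isProbabilityMeasure_map hr₂.aemeasurable
  have h₁ : IsPoissonPointProcess (ι.restrict W₁) (P.map (PointConfig.restrict W₁)) :=
    IsPoissonPointProcess.restrict_holds hP hW₁
  have h₂ : IsPoissonPointProcess (ι.restrict W₂) (P.map (PointConfig.restrict W₂)) :=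
    IsPoissonPointProcess.restrict_holds hP hW₂
  have h₁₂ : IsPoissonPointProcess (ι.restrict (W₁ ∪ W₂)) (P.map (PointConfig.restrict (W₁ ∪ W₂))) :=
    IsPoissonPointProcess.restrict_holds hP (hW₁.union hW₂)
  have hsup : IsPoissonPointProcess (ι.restrict W₁ + ι.restrict W₂)
      (((P.map (PointConfig.restrict W₁)).prod (P.map (PointConfig.restrict W₂))).map
        fun p : PointConfig E × PointConfig E => p.1 ∪ p.2) :=
    IsPoissonPointProcess.superposition_holds h₁ h₂
  rw [← Measure.restrict_union hd hW₂] at hsup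
  have hEq : P.map (PointConfig.restrict (W₁ ∪ W₂)) =
      ((P.map (PointConfig.restrict W₁)).prod (P.map (PointConfig.restrict W₂))).map
        (fun p : PointConfig E × PointConfig E => p.1 ∪ p.2) :=
    IsPoissonPointProcess.unique_holds h₁₂ hsup
  -- the pair of restrictions factors through the restriction to the union ...
  have hT12 : (fun c : PointConfig E => (PointConfig.restrict W₁ c, PointConfig.restrict W₂ c)) ∘
      PointConfig.restrict (W₁ ∪ W₂) =
      fun c => (PointConfig.restrict W₁ c, PointConfig.restrict W₂ c) := by
    funext c
    show (PointConfig.restrict W₁ (PointConfig.restrict (W₁ ∪ W₂) c),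
      PointConfig.restrict W₂ (PointConfig.restrict (W₁ ∪ W₂) c)) = _
    rw [restrict_restrict_config, restrict_restrict_config, union_inter_cancel_left,
      union_inter_cancel_right]
  -- ... and inverts superposition almost surely under the product law
  have hTU : ((fun c : PointConfig E => (PointConfig.restrict W₁ c, PointConfig.restrict W₂ c)) ∘
      fun p : PointConfig E × PointConfig E => p.1 ∪ p.2) =ᵐ[(P.map (PointConfig.restrict W₁)).prod
        (P.map (PointConfig.restrict W₂))] id := by
    have a1 : ∀ᵐ p ∂(P.map (PointConfig.restrict W₁)).prod (P.map (PointConfig.restrict W₂)),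
        p.1.carrier ⊆ W₁ :=
      (Measure.quasiMeasurePreserving_fst (μ := P.map (PointConfig.restrict W₁))
        (ν := P.map (PointConfig.restrict W₂))).ae (ae_map_restrict_carrier_subset hW₁ P)
    have a2 : ∀ᵐ p ∂(P.map (PointConfig.restrict W₁)).prod (P.map (PointConfig.restrict W₂)),
        p.2.carrier ⊆ W₂ :=
      (Measure.quasiMeasurePreserving_snd (μ := P.map (PointConfig.restrict W₁))
        (ν := P.map (PointConfig.restrict W₂))).ae (ae_map_restrict_carrier_subset hW₂ P)
    filter_upwards [a1, a2] with p h1 h2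
    simp only [Function.comp_apply, id_eq]
    exact Prod.ext (restrict_union_config_left hd h1 h2) (restrict_union_config_right hd h1 h2)
  calc P.map (fun c => (PointConfig.restrict W₁ c, PointConfig.restrict W₂ c))
      = P.map ((fun c : PointConfig E => (PointConfig.restrict W₁ c, PointConfig.restrict W₂ c)) ∘
          PointConfig.restrict (W₁ ∪ W₂)) := by rw [hT12]
    _ = (P.map (PointConfig.restrict (W₁ ∪ W₂))).map
          (fun c => (PointConfig.restrict W₁ c, PointConfig.restrict W₂ c)) :=
        (Measure.map_map hT hr₁₂).symm
    _ = (((P.map (PointConfig.restrict W₁)).prod (P.map (PointConfig.restrict W₂))).map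
          (fun p : PointConfig E × PointConfig E => p.1 ∪ p.2)).map
          (fun c => (PointConfig.restrict W₁ c, PointConfig.restrict W₂ c)) := by rw [hEq]
    _ = ((P.map (PointConfig.restrict W₁)).prod (P.map (PointConfig.restrict W₂))).map
          ((fun c : PointConfig E => (PointConfig.restrict W₁ c, PointConfig.restrict W₂ c)) ∘
            fun p : PointConfig E × PointConfig E => p.1 ∪ p.2) := Measure.map_map hT hU
    _ = ((P.map (PointConfig.restrict W₁)).prod (P.map (PointConfig.restrict W₂))).map id :=
        Measure.map_congr hTU
    _ = (P.map (PointConfig.restrict W₁)).prod (P.map (PointConfig.restrict W₂)) := Measure.map_id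

end Poisson

/-! ## Part III — the window entropy relative to the free gas: superadditivity and invariance -/

section Window

variable {d : Type*} [Fintype d]

omit [Fintype d] in
/-- The window over a union is the union of the windows. [folklore] -/
theorem window_union (Λ₁ Λ₂ : Set (EuclideanSpace ℝ d)) : window (Λ₁ ∪ Λ₂) = window Λ₁ ∪ window Λ₂ :=
  union_prod

omit [Fintype d] in
/-- Windows over disjoint regions are disjoint. [folklore] -/
theorem disjoint_window {Λ₁ Λ₂ : Set (EuclideanSpace ℝ d)} (h : Disjoint Λ₁ Λ₂) : Disjoint (window Λ₁) (window Λ₂) :=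
  Set.disjoint_prod.2 (Or.inl h)

/-- **Superadditivity of the window entropy relative to the free gas over disjoint regions**:
`H_{Λ₁}(ν | π) + H_{Λ₂}(ν | π) ≤ H_{Λ₁ ∪ Λ₂}(ν | π)` for disjoint measurable `Λ₁, Λ₂ ⊆ ℝ^d`, `ν` a
law on configurations and `π` a Poisson process with intensity `Leb ⊗ m` (`m` finite).  The window
marginal of `π` over `Λ₁ ∪ Λ₂` is the product of the marginals over `Λ₁` and `Λ₂`
(`IsPoissonPointProcess.map_restrict_prodMk_restrict`), the relative entropy is transported along
the pair-of-restrictions map (`klDiv_map_eq_of_leftInvOn`), and relative entropy is superadditive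
with respect to a product reference (`klDiv_map_fst_add_klDiv_map_snd_le`); Georgii–Zessin 1993
Remark 2.5 (1) ("proved in the same way as the analogous results for lattice systems", Georgii,
*Gibbs Measures and Phase Transitions*, §15.1–15.2). [cite: GeorgiiZessin1993, Remark 2.5 (1)] -/
theorem windowRelEntropy_union_ge {m : Measure (EuclideanSpace ℝ d)} [IsFiniteMeasure m]
    {π ν : Measure (PointConfig ((EuclideanSpace ℝ d) × (EuclideanSpace ℝ d)))} (hπ : IsPoissonPointProcess ((volume : Measure (EuclideanSpace ℝ d)).prod m) π)
    [IsProbabilityMeasure ν] {Λ₁ Λ₂ : Set (EuclideanSpace ℝ d)} (hΛ₁ : MeasurableSet Λ₁) (hΛ₂ : MeasurableSet Λ₂)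
    (hd : Disjoint Λ₁ Λ₂) :
    windowRelEntropy Λ₁ ν π + windowRelEntropy Λ₂ ν π ≤ windowRelEntropy (Λ₁ ∪ Λ₂) ν π := by
  haveI := hπ.isProbabilityMeasure
  have hW₁ : MeasurableSet (window Λ₁) := measurableSet_window hΛ₁
  have hW₂ : MeasurableSet (window Λ₂) := measurableSet_window hΛ₂
  have hW₁₂ : MeasurableSet (window Λ₁ ∪ window Λ₂) := hW₁.union hW₂
  have hdW : Disjoint (window Λ₁) (window Λ₂) := disjoint_window hd
  have hr₁ : Measurable (PointConfig.restrict (window Λ₁) :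
      PointConfig ((EuclideanSpace ℝ d) × (EuclideanSpace ℝ d)) → PointConfig ((EuclideanSpace ℝ d) × (EuclideanSpace ℝ d))) := PointConfig.measurable_restrict hW₁
  have hr₂ : Measurable (PointConfig.restrict (window Λ₂) :
      PointConfig ((EuclideanSpace ℝ d) × (EuclideanSpace ℝ d)) → PointConfig ((EuclideanSpace ℝ d) × (EuclideanSpace ℝ d))) := PointConfig.measurable_restrict hW₂
  have hr₁₂ : Measurable (PointConfig.restrict (window Λ₁ ∪ window Λ₂) :
      PointConfig ((EuclideanSpace ℝ d) × (EuclideanSpace ℝ d)) → PointConfig ((EuclideanSpace ℝ d) × (EuclideanSpace ℝ d))) := PointConfig.measurable_restrict hW₁₂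
  set T : PointConfig ((EuclideanSpace ℝ d) × (EuclideanSpace ℝ d)) → PointConfig ((EuclideanSpace ℝ d) × (EuclideanSpace ℝ d)) × PointConfig ((EuclideanSpace ℝ d) × (EuclideanSpace ℝ d)) :=
    fun c => (PointConfig.restrict (window Λ₁) c, PointConfig.restrict (window Λ₂) c) with hT
  have hTm : Measurable T := hr₁.prodMk hr₂
  have hU : Measurable fun p : PointConfig ((EuclideanSpace ℝ d) × (EuclideanSpace ℝ d)) × PointConfig ((EuclideanSpace ℝ d) × (EuclideanSpace ℝ d)) => p.1 ∪ p.2 :=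
    PointConfig.measurable_union'
  haveI : IsProbabilityMeasure (ν.map T) := Measure.isProbabilityMeasure_map hTm.aemeasurable
  haveI : IsProbabilityMeasure (π.map (PointConfig.restrict (window Λ₁))) :=
    Measure.isProbabilityMeasure_map hr₁.aemeasurable
  haveI : IsProbabilityMeasure (π.map (PointConfig.restrict (window Λ₂))) :=
    Measure.isProbabilityMeasure_map hr₂.aemeasurable
  haveI : IsProbabilityMeasure (windowLaw Λ₁ π) := isProbabilityMeasure_windowLaw hΛ₁ π
  haveI : IsProbabilityMeasure (windowLaw Λ₂ π) := isProbabilityMeasure_windowLaw hΛ₂ π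
  -- the three window marginals of `ν` in terms of `T`
  have hT12 : T ∘ PointConfig.restrict (window Λ₁ ∪ window Λ₂) = T := by
    funext c
    show (PointConfig.restrict (window Λ₁) (PointConfig.restrict (window Λ₁ ∪ window Λ₂) c),
      PointConfig.restrict (window Λ₂) (PointConfig.restrict (window Λ₁ ∪ window Λ₂) c)) = _
    rw [restrict_restrict_config, restrict_restrict_config, union_inter_cancel_left,
      union_inter_cancel_right]
  have hfst : (ν.map T).map Prod.fst = windowLaw Λ₁ ν := by
    rw [Measure.map_map measurable_fst hTm]
    rfl
  have hsnd : (ν.map T).map Prod.snd = windowLaw Λ₂ ν := by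
    rw [Measure.map_map measurable_snd hTm]
    rfl
  -- transport of the entropy over `Λ₁ ∪ Λ₂` along `T`
  have htrans : windowRelEntropy (Λ₁ ∪ Λ₂) ν π = klDiv (ν.map T) (π.map T) := by
    rw [windowRelEntropy_def, windowLaw_def, windowLaw_def, window_union]
    have hA := measurableSet_setOf_carrier_subset (E := (EuclideanSpace ℝ d) × (EuclideanSpace ℝ d)) hW₁₂
    have key := klDiv_map_eq_of_leftInvOn (a := ν.map (PointConfig.restrict (window Λ₁ ∪ window Λ₂)))
      (b := π.map (PointConfig.restrict (window Λ₁ ∪ window Λ₂))) hTm hU hA ?_ ?_ ?_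
    · rw [Measure.map_map hTm hr₁₂, Measure.map_map hTm hr₁₂, hT12] at key
      exact key.symm
    · exact mem_ae_iff.1 (ae_map_restrict_carrier_subset hW₁₂ ν)
    · exact mem_ae_iff.1 (ae_map_restrict_carrier_subset hW₁₂ π)
    · intro c hc
      simp only [hT, restrict_union_restrict_config]
      exact restrict_config_eq_self hc
  rw [htrans, IsPoissonPointProcess.map_restrict_prodMk_restrict hπ hW₁ hW₂ hdW,
    windowRelEntropy_def, windowRelEntropy_def, ← hfst, ← hsnd]
  exact klDiv_map_fst_add_klDiv_map_snd_le (ν.map T) _ _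

/-! ### Monotonicity and finite superadditivity -/

/-- **Monotonicity of the window entropy relative to the free gas**: `H_Λ(ν | π) ≤ H_{Λ'}(ν | π)`
for measurable `Λ ⊆ Λ'` (from superadditivity over `Λ' = Λ ∪ (Λ' \ Λ)` and `H ≥ 0`).
[cite: GeorgiiZessin1993, Remark 2.5 (1)] -/
theorem windowRelEntropy_mono_set {m : Measure (EuclideanSpace ℝ d)} [IsFiniteMeasure m]
    {π ν : Measure (PointConfig ((EuclideanSpace ℝ d) × (EuclideanSpace ℝ d)))} (hπ : IsPoissonPointProcess ((volume : Measure (EuclideanSpace ℝ d)).prod m) π)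
    [IsProbabilityMeasure ν] {Λ Λ' : Set (EuclideanSpace ℝ d)} (hΛ : MeasurableSet Λ) (hΛ' : MeasurableSet Λ')
    (h : Λ ⊆ Λ') : windowRelEntropy Λ ν π ≤ windowRelEntropy Λ' ν π := by
  calc windowRelEntropy Λ ν π ≤ windowRelEntropy Λ ν π + windowRelEntropy (Λ' \ Λ) ν π :=
        le_self_add
    _ ≤ windowRelEntropy (Λ ∪ Λ' \ Λ) ν π :=
        windowRelEntropy_union_ge hπ hΛ (hΛ'.diff hΛ) disjoint_sdiff_right
    _ = windowRelEntropy Λ' ν π := by rw [union_sdiff_cancel h]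

/-- **Finite superadditivity of the window entropy relative to the free gas**: for finitely many
pairwise disjoint measurable regions, `∑ᵢ H_{Λᵢ}(ν | π) ≤ H_{⋃ᵢ Λᵢ}(ν | π)`.
[cite: GeorgiiZessin1993, Remark 2.5 (1)] -/
theorem sum_windowRelEntropy_le_biUnion {m : Measure (EuclideanSpace ℝ d)} [IsFiniteMeasure m]
    {π ν : Measure (PointConfig ((EuclideanSpace ℝ d) × (EuclideanSpace ℝ d)))} (hπ : IsPoissonPointProcess ((volume : Measure (EuclideanSpace ℝ d)).prod m) π)
    [IsProbabilityMeasure ν] {ι : Type*} (s : Finset ι) {Λ : ι → Set (EuclideanSpace ℝ d)}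
    (hm : ∀ i, MeasurableSet (Λ i)) (hd : Pairwise (Function.onFun Disjoint Λ)) :
    ∑ i ∈ s, windowRelEntropy (Λ i) ν π ≤ windowRelEntropy (⋃ i ∈ s, Λ i) ν π := by
  classical
  induction s using Finset.induction_on with
  | empty => simp
  | @insert a s ha ih =>
    rw [Finset.sum_insert ha, Finset.set_biUnion_insert]
    have hdisj : Disjoint (Λ a) (⋃ i ∈ s, Λ i) := by
      refine disjoint_iUnion₂_right.2 fun i hi => hd ?_
      rintro rfl
      exact ha hi
    calc windowRelEntropy (Λ a) ν π + ∑ i ∈ s, windowRelEntropy (Λ i) ν π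
        ≤ windowRelEntropy (Λ a) ν π + windowRelEntropy (⋃ i ∈ s, Λ i) ν π := by gcongr
      _ ≤ windowRelEntropy (Λ a ∪ ⋃ i ∈ s, Λ i) ν π :=
          windowRelEntropy_union_ge hπ (hm a) (Finset.measurableSet_biUnion s fun i _ => hm i) hdisj

/-! ### Translation invariance -/

omit [Fintype d] in
/-- The window over a translated region is the translate (in position) of the window.
[folklore] -/
theorem window_image_add (Λ : Set (EuclideanSpace ℝ d)) (x : (EuclideanSpace ℝ d)) :
    window ((fun q : (EuclideanSpace ℝ d) => q + x) '' Λ) = (fun p : (EuclideanSpace ℝ d) × (EuclideanSpace ℝ d) => p + (x, 0)) '' window Λ := by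
  ext ⟨q, w⟩
  simp only [mem_window, mem_image, Prod.exists, Prod.mk_add_mk, Prod.mk.injEq, add_zero]
  constructor
  · rintro ⟨q₀, hq₀, rfl⟩
    exact ⟨q₀, w, hq₀, rfl, rfl⟩
  · rintro ⟨q₀, w₀, hq₀, rfl, rfl⟩
    exact ⟨q₀, hq₀, rfl⟩

/-- Restriction to a translated set of a translated configuration is the translate of the
restriction. [folklore] -/
theorem restrict_image_translate (W : Set ((EuclideanSpace ℝ d) × (EuclideanSpace ℝ d))) (v : (EuclideanSpace ℝ d) × (EuclideanSpace ℝ d)) (c : PointConfig ((EuclideanSpace ℝ d) × (EuclideanSpace ℝ d))) :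
    PointConfig.restrict ((fun p => p + v) '' W) (PointConfig.translate v c) =
      PointConfig.translate v (PointConfig.restrict W c) := by
  ext y
  change y ∈ ((· + v) '' c.carrier) ∩ ((· + v) '' W) ↔ y ∈ (· + v) '' (c.carrier ∩ W)
  rw [image_inter (add_left_injective v)]

/-- Translating back recovers the configuration. [folklore] -/
theorem translate_neg_translate (v : (EuclideanSpace ℝ d) × (EuclideanSpace ℝ d)) (c : PointConfig ((EuclideanSpace ℝ d) × (EuclideanSpace ℝ d))) :
    PointConfig.translate (-v) (PointConfig.translate v c) = c := by
  ext y
  change y ∈ (· + -v) '' ((· + v) '' c.carrier) ↔ y ∈ c.carrier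
  rw [image_image]
  simp

/-- The window marginal over a translated region of a translation-invariant law is the translate
of the window marginal. [folklore] -/
theorem windowLaw_image_add {ν : Measure (PointConfig ((EuclideanSpace ℝ d) × (EuclideanSpace ℝ d)))} {x : (EuclideanSpace ℝ d)}
    (hν : ν.map (PointConfig.translate ((x, 0) : (EuclideanSpace ℝ d) × (EuclideanSpace ℝ d))) = ν) {Λ : Set (EuclideanSpace ℝ d)}
    (hΛ : MeasurableSet Λ) :
    windowLaw ((fun q : (EuclideanSpace ℝ d) => q + x) '' Λ) ν =
      (windowLaw Λ ν).map (PointConfig.translate ((x, 0) : (EuclideanSpace ℝ d) × (EuclideanSpace ℝ d))) := by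
  have hτ : Measurable (PointConfig.translate ((x, 0) : (EuclideanSpace ℝ d) × (EuclideanSpace ℝ d)) :
      PointConfig ((EuclideanSpace ℝ d) × (EuclideanSpace ℝ d)) → PointConfig ((EuclideanSpace ℝ d) × (EuclideanSpace ℝ d))) := PointConfig.measurable_translate _
  have hWm : MeasurableSet ((fun p : (EuclideanSpace ℝ d) × (EuclideanSpace ℝ d) => p + (x, 0)) '' window Λ) := by
    rw [image_add_right]
    exact measurableSet_preimage (measurable_add_const _) (measurableSet_window hΛ)
  have hfun : PointConfig.restrict ((fun p : (EuclideanSpace ℝ d) × (EuclideanSpace ℝ d) => p + (x, 0)) '' window Λ) ∘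
      PointConfig.translate ((x, 0) : (EuclideanSpace ℝ d) × (EuclideanSpace ℝ d)) =
      PointConfig.translate ((x, 0) : (EuclideanSpace ℝ d) × (EuclideanSpace ℝ d)) ∘ PointConfig.restrict (window Λ) := by
    funext c
    exact restrict_image_translate (window Λ) (x, 0) c
  rw [windowLaw_def, windowLaw_def, window_image_add]
  conv_lhs => rw [← hν]
  rw [Measure.map_map (PointConfig.measurable_restrict hWm) hτ, hfun,
    Measure.map_map hτ (PointConfig.measurable_restrict (measurableSet_window hΛ))]

/-- The free gas is translation invariant: a Poisson process with intensity `Leb ⊗ m` is invariant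
under the spatial translations `ω ↦ ω + (x, 0)` (Kingman's Mapping Theorem with Rényi uniqueness,
`IsPoissonPointProcess.map_translate_holds`, and translation invariance of Lebesgue measure).
[cite: Kingman1993, §2.3 Mapping Theorem] -/
theorem _root_.Literature.Analysis.FunctionSpaces.IsPoissonPointProcess.isTranslationInvariant
    {m : Measure (EuclideanSpace ℝ d)} [IsFiniteMeasure m] {π : Measure (PointConfig ((EuclideanSpace ℝ d) × (EuclideanSpace ℝ d)))}
    (hπ : IsPoissonPointProcess ((volume : Measure (EuclideanSpace ℝ d)).prod m) π) :
    IsTranslationInvariant π := by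
  intro x
  refine IsPoissonPointProcess.map_translate_holds hπ ((x, 0) : (EuclideanSpace ℝ d) × (EuclideanSpace ℝ d)) ?_
  have h1 : (fun p : (EuclideanSpace ℝ d) × (EuclideanSpace ℝ d) => p + (x, 0)) = Prod.map (fun q : (EuclideanSpace ℝ d) => q + x) id := by
    funext p
    ext1
    · rfl
    · exact add_zero _
  rw [h1, ← Measure.map_prod_map _ _ (measurable_add_const x) measurable_id, Measure.map_id,
    map_add_right_eq_self]

/-- **Translation invariance of the window entropy**: for translation-invariant `ν` and `π`,
`H_{Λ + x}(ν | π) = H_Λ(ν | π)` (both window marginals over `Λ + x` are the images of those over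
`Λ` under the measurable bijection `ω ↦ ω + (x, 0)` of configurations, under which the relative
entropy is invariant, `klDiv_map_eq_of_leftInverse`). [cite: GeorgiiZessin1993, §2.1 and Remark 2.5 (1)] -/
theorem windowRelEntropy_image_add {ν π : Measure (PointConfig ((EuclideanSpace ℝ d) × (EuclideanSpace ℝ d)))} [IsFiniteMeasure ν]
    [IsFiniteMeasure π] (hν : IsTranslationInvariant ν) (hπ : IsTranslationInvariant π)
    {Λ : Set (EuclideanSpace ℝ d)} (hΛ : MeasurableSet Λ) (x : (EuclideanSpace ℝ d)) :
    windowRelEntropy ((fun q : (EuclideanSpace ℝ d) => q + x) '' Λ) ν π = windowRelEntropy Λ ν π := by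
  rw [windowRelEntropy_def, windowRelEntropy_def, windowLaw_image_add (hν x) hΛ,
    windowLaw_image_add (hπ x) hΛ]
  exact klDiv_map_eq_of_leftInverse (PointConfig.measurable_translate _)
    (PointConfig.measurable_translate (-((x, 0) : (EuclideanSpace ℝ d) × (EuclideanSpace ℝ d)))) (translate_neg_translate (x, 0))

omit [Fintype d] in
/-- A translate of a box is a box. [folklore] -/
theorem image_add_box (a b c : d → ℝ) :
    (fun q : (EuclideanSpace ℝ d) => q + WithLp.toLp 2 c) '' box a b = box (fun i => a i + c i) (fun i => b i + c i) := by
  ext q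
  simp only [mem_image, mem_box, mem_Ioo]
  constructor
  · rintro ⟨q₀, hq₀, rfl⟩ i
    have := hq₀ i
    simp only [PiLp.add_apply]
    exact ⟨by linarith [this.1], by linarith [this.2]⟩
  · intro hq
    refine ⟨q - WithLp.toLp 2 c, fun i => ?_, sub_add_cancel _ _⟩
    have := hq i
    simp only [PiLp.sub_apply]
    exact ⟨by linarith [this.1], by linarith [this.2]⟩

/-- **Translation invariance of the window entropy over boxes**:
`H_{∏ (aᵢ + cᵢ, bᵢ + cᵢ)}(ν | π) = H_{∏ (aᵢ, bᵢ)}(ν | π)` for translation-invariant `ν`, `π`.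
[cite: GeorgiiZessin1993, Remark 2.5 (1)] -/
theorem windowRelEntropy_box_add {ν π : Measure (PointConfig ((EuclideanSpace ℝ d) × (EuclideanSpace ℝ d)))} [IsFiniteMeasure ν]
    [IsFiniteMeasure π] (hν : IsTranslationInvariant ν) (hπ : IsTranslationInvariant π)
    (a b c : d → ℝ) :
    windowRelEntropy (box (fun i => a i + c i) (fun i => b i + c i)) ν π =
      windowRelEntropy (box a b) ν π := by
  rw [← image_add_box, windowRelEntropy_image_add hν hπ (measurableSet_box a b)]

end Window

/-! ## Part IV — cells in a cube and the limit along cubes -/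

section Cubes

variable {d : Type*} [Fintype d]

omit [Fintype d] in
/-- The cells `∏ᵢ (-n + jᵢ ℓ, -n + (jᵢ + 1) ℓ)`, `j ∈ {0, …, k-1}^d`, are pairwise disjoint.
[folklore] -/
theorem pairwise_disjoint_cells (n ℓ : ℝ) (hℓ : 0 ≤ ℓ) (k : ℕ) :
    Pairwise (Function.onFun Disjoint fun j : d → Fin k =>
      (box (fun i => -n + (j i : ℕ) * ℓ) (fun i => -n + (j i : ℕ) * ℓ + ℓ) : Set (EuclideanSpace ℝ d))) := by
  intro j j' hjj'
  obtain ⟨i, hi⟩ : ∃ i, j i ≠ j' i := Function.ne_iff.1 hjj'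
  have key : ∀ {u w : Fin k}, (u : ℕ) < (w : ℕ) → ∀ q : (EuclideanSpace ℝ d),
      q i ∈ Ioo (-n + (u : ℕ) * ℓ) (-n + (u : ℕ) * ℓ + ℓ) →
      q i ∈ Ioo (-n + (w : ℕ) * ℓ) (-n + (w : ℕ) * ℓ + ℓ) → False := by
    intro u w huw q h1 h2
    have h3 : ((u : ℕ) : ℝ) + 1 ≤ ((w : ℕ) : ℝ) := by exact_mod_cast huw
    nlinarith [h1.2, h2.1, mul_le_mul_of_nonneg_right h3 hℓ]
  rcases lt_or_gt_of_ne (Fin.val_injective.ne hi) with hlt | hlt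
  · exact Set.disjoint_left.2 fun q hq hq' => key hlt q (hq i) (hq' i)
  · exact Set.disjoint_left.2 fun q hq hq' => key hlt q (hq' i) (hq i)

omit [Fintype d] in
/-- The cells `∏ᵢ (-n + jᵢ ℓ, -n + (jᵢ + 1) ℓ)`, `j ∈ {0, …, k-1}^d`, lie in the cube `(-n, n)^d`
as soon as `k ℓ ≤ 2n`. [folklore] -/
theorem cell_subset_cube {n ℓ : ℝ} (hℓ : 0 ≤ ℓ) {k : ℕ} (hk : (k : ℝ) * ℓ ≤ 2 * n) (j : d → Fin k) :
    (box (fun i => -n + (j i : ℕ) * ℓ) (fun i => -n + (j i : ℕ) * ℓ + ℓ) : Set (EuclideanSpace ℝ d)) ⊆ cube n := by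
  intro q hq
  rw [cube_def, mem_box]
  intro i
  have h := hq i
  have h0 : (0 : ℝ) ≤ ((j i : ℕ) : ℝ) * ℓ := mul_nonneg (Nat.cast_nonneg _) hℓ
  have h1 : (((j i : ℕ) : ℝ) + 1) * ℓ ≤ (k : ℝ) * ℓ := by
    refine mul_le_mul_of_nonneg_right ?_ hℓ
    exact_mod_cast Nat.succ_le_of_lt (j i).isLt
  simp only [mem_Ioo] at h ⊢
  constructor
  · linarith [h.1]
  · nlinarith [h.2]

/-- **Lower bound by tiling**: for a translation-invariant law `ν`, the free gas `π`, an open cube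
`C = ∏ᵢ (aᵢ, aᵢ + ℓ)` and `k ℓ ≤ 2n`, the cube `(-n, n)^d` contains `k^d` disjoint translates of
`C`, whence `k^d · H_C(ν | π) ≤ H_{(-n,n)^d}(ν | π)` by superadditivity and translation invariance
(the tiling step of the multidimensional subadditivity lemma, Georgii, *Gibbs Measures and Phase
Transitions*, Lemma 15.11). [cite: GeorgiiZessin1993, Remark 2.5 (1)] -/
theorem pow_mul_windowRelEntropy_box_le_cube {m : Measure (EuclideanSpace ℝ d)} [IsFiniteMeasure m]
    {π ν : Measure (PointConfig ((EuclideanSpace ℝ d) × (EuclideanSpace ℝ d)))} (hπ : IsPoissonPointProcess ((volume : Measure (EuclideanSpace ℝ d)).prod m) π)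
    [IsProbabilityMeasure ν] (hν : IsTranslationInvariant ν) (a : d → ℝ) {ℓ : ℝ} (hℓ : 0 < ℓ)
    {n : ℝ} {k : ℕ} (hk : (k : ℝ) * ℓ ≤ 2 * n) :
    (k : ℝ≥0∞) ^ Fintype.card d * windowRelEntropy (box a fun i => a i + ℓ) ν π ≤
      windowRelEntropy (cube n) ν π := by
  classical
  haveI := hπ.isProbabilityMeasure
  have hπinv : IsTranslationInvariant π := hπ.isTranslationInvariant
  set cell : (d → Fin k) → Set (EuclideanSpace ℝ d) := fun j =>
    box (fun i => -n + (j i : ℕ) * ℓ) (fun i => -n + (j i : ℕ) * ℓ + ℓ) with hcell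
  have hcellm : ∀ j, MeasurableSet (cell j) := fun j => measurableSet_box _ _
  have hcelld : Pairwise (Function.onFun Disjoint cell) := pairwise_disjoint_cells n ℓ hℓ.le k
  -- each cell is a translate of `C` and has the same entropy
  have hcellH : ∀ j, windowRelEntropy (cell j) ν π = windowRelEntropy (box a fun i => a i + ℓ) ν π := by
    intro j
    have e : cell j = box (fun i => a i + (-n + (j i : ℕ) * ℓ - a i))
        (fun i => (a i + ℓ) + (-n + (j i : ℕ) * ℓ - a i)) := by
      simp only [hcell]
      congr 1 <;> funext i <;> ring
    rw [e]
    exact windowRelEntropy_box_add hν hπinv a (fun i => a i + ℓ) _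
  calc (k : ℝ≥0∞) ^ Fintype.card d * windowRelEntropy (box a fun i => a i + ℓ) ν π
      = ∑ j : d → Fin k, windowRelEntropy (cell j) ν π := by
        rw [Finset.sum_congr rfl fun j _ => hcellH j, Finset.sum_const, Finset.card_univ,
          Fintype.card_fun, Fintype.card_fin, nsmul_eq_mul]
        push_cast
        ring
    _ ≤ windowRelEntropy (⋃ j ∈ (Finset.univ : Finset (d → Fin k)), cell j) ν π :=
        sum_windowRelEntropy_le_biUnion hπ Finset.univ hcellm hcelld
    _ ≤ windowRelEntropy (cube n) ν π := by
        refine windowRelEntropy_mono_set hπ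
          (Finset.measurableSet_biUnion _ fun j _ => hcellm j) (measurableSet_cube n) ?_
        exact iUnion₂_subset fun j _ => cell_subset_cube hℓ.le hk j

/-- The real sequence `⌊2n/ℓ⌋ / (2n)` tends to `1/ℓ`. [folklore] -/
theorem tendsto_floor_div (ℓ : ℝ) (hℓ : 0 < ℓ) :
    Tendsto (fun n : ℕ => (⌊2 * (n : ℝ) / ℓ⌋₊ : ℝ) / (2 * n)) atTop (𝓝 (1 / ℓ)) := by
  have h2n : Tendsto (fun n : ℕ => (2 : ℝ) * n) atTop atTop :=
    tendsto_natCast_atTop_atTop.const_mul_atTop zero_lt_two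
  have hlow : Tendsto (fun n : ℕ => 1 / ℓ - 1 / (2 * (n : ℝ))) atTop (𝓝 (1 / ℓ)) := by
    have := (tendsto_const_nhds (x := (1 : ℝ) / ℓ)).sub (h2n.inv_tendsto_atTop)
    simpa [one_div] using this
  refine tendsto_of_tendsto_of_tendsto_of_le_of_le' hlow tendsto_const_nhds ?_ ?_
  · filter_upwards [eventually_ge_atTop 1] with n hn
    have hn' : (0 : ℝ) < 2 * n := by positivity
    have h1 := Nat.lt_floor_add_one (2 * (n : ℝ) / ℓ)
    rw [le_div_iff₀ hn', sub_mul, one_div_mul_eq_div, one_div_mul_cancel hn'.ne']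
    linarith [h1]
  · filter_upwards [eventually_ge_atTop 1] with n hn
    have hn' : (0 : ℝ) < 2 * n := by positivity
    have h1 := Nat.floor_le (show (0 : ℝ) ≤ 2 * n / ℓ by positivity)
    rw [div_le_iff₀ hn', one_div_mul_eq_div]
    exact h1

end Cubes

/-! ## Part V — the theorem -/

section Main

variable {d : Type*} [Fintype d]

/-- **Existence of the specific entropy relative to the free gas** (discharge of the named fact
`GeorgiiZessin1993_specificEntropy`; Georgii–Zessin 1993 (2.12) and Remark 2.5 (1), p. 184): for a
translation-invariant law `ν` and the Poisson process `π` with intensity `Leb ⊗ m`, the specific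
entropy `s(ν | π) = lim_n H_{(-n,n)^d}(ν | π) / (2n)^d` exists and equals the supremum of
`H_C(ν | π) / |C|` over all open cubes `C`.  Proof as for lattice systems (Georgii, *Gibbs Measures
and Phase Transitions*, §15.2): `H_Λ / |Λ| ≤ sup` trivially along the cubes, and for each cube `C`
of side `ℓ`, tiling `(-n, n)^d` by `⌊2n/ℓ⌋^d` disjoint translates of `C`
(`pow_mul_windowRelEntropy_box_le_cube`) gives `liminf ≥ H_C / |C|`.
[cite: GeorgiiZessin1993, §2.3 (2.12) and Remark 2.5 (1)] -/
theorem GeorgiiZessin1993_specificEntropy_holds : GeorgiiZessin1993_specificEntropy (d := d) := by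
  intro m _ _ π ν hπ _ hν _
  haveI := hπ.isProbabilityMeasure
  -- the sequence and the supremum
  set s : ℕ → ℝ≥0∞ := fun n =>
    windowRelEntropy (cube (n : ℝ)) ν π / volume (cube (n : ℝ) : Set (EuclideanSpace ℝ d)) with hs
  set S : ℝ≥0∞ := ⨆ (a : d → ℝ) (ℓ : ℝ) (_ : 0 < ℓ),
    windowRelEntropy (box a fun i => a i + ℓ) ν π / volume (box a (fun i => a i + ℓ) : Set (EuclideanSpace ℝ d))
    with hS
  -- upper bound: the cubes are among the boxes
  have h_up : ∀ n : ℕ, 1 ≤ n → s n ≤ S := by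
    intro n hn
    have hn' : (0 : ℝ) < 2 * n := by positivity
    have hcube : (cube (n : ℝ) : Set (EuclideanSpace ℝ d)) =
        box (fun _ => -(n : ℝ)) (fun i => (fun _ : d => -(n : ℝ)) i + 2 * n) := by
      rw [cube_def]
      congr 1
      funext i
      ring
    show windowRelEntropy (cube (n : ℝ)) ν π / volume (cube (n : ℝ) : Set (EuclideanSpace ℝ d)) ≤ S
    rw [hcube]
    exact le_iSup₂_of_le (f := fun (a : d → ℝ) (ℓ : ℝ) => ⨆ (_ : 0 < ℓ),
      windowRelEntropy (box a fun i => a i + ℓ) ν π / volume (box a (fun i => a i + ℓ) : Set (EuclideanSpace ℝ d)))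
      (fun _ => -(n : ℝ)) (2 * n) (le_iSup_of_le hn' le_rfl)
  have h_limsup : limsup s atTop ≤ S := limsup_le_of_le (h := eventually_atTop.2 ⟨1, h_up⟩)
  -- lower bound: tiling
  have h_low : ∀ (a : d → ℝ) (ℓ : ℝ), 0 < ℓ →
      windowRelEntropy (box a fun i => a i + ℓ) ν π / volume (box a (fun i => a i + ℓ) : Set (EuclideanSpace ℝ d)) ≤
        liminf s atTop := by
    intro a ℓ hℓ
    set H := windowRelEntropy (box a fun i => a i + ℓ) ν π with hH
    have hvol : volume (box a (fun i => a i + ℓ) : Set (EuclideanSpace ℝ d)) = ENNReal.ofReal (ℓ ^ Fintype.card d) := by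
      rw [volume_box, ENNReal.ofReal_pow hℓ.le]
      simp
    -- the comparison sequence `c n * H ≤ s n`
    set c : ℕ → ℝ≥0∞ := fun n =>
      (⌊2 * (n : ℝ) / ℓ⌋₊ : ℝ≥0∞) ^ Fintype.card d / volume (cube (n : ℝ) : Set (EuclideanSpace ℝ d)) with hc
    have hcs : ∀ n : ℕ, c n * H ≤ s n := by
      intro n
      have hk : (⌊2 * (n : ℝ) / ℓ⌋₊ : ℝ) * ℓ ≤ 2 * n := by
        have h0 := Nat.floor_le (show (0 : ℝ) ≤ 2 * n / ℓ by positivity)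
        calc (⌊2 * (n : ℝ) / ℓ⌋₊ : ℝ) * ℓ ≤ 2 * n / ℓ * ℓ := mul_le_mul_of_nonneg_right h0 hℓ.le
          _ = 2 * n := div_mul_cancel₀ _ hℓ.ne'
      have h1 := pow_mul_windowRelEntropy_box_le_cube hπ hν a hℓ hk
      calc c n * H = (⌊2 * (n : ℝ) / ℓ⌋₊ : ℝ≥0∞) ^ Fintype.card d * H /
            volume (cube (n : ℝ) : Set (EuclideanSpace ℝ d)) := by
            simp only [hc, div_eq_mul_inv]
            ring
        _ ≤ windowRelEntropy (cube (n : ℝ)) ν π / volume (cube (n : ℝ) : Set (EuclideanSpace ℝ d)) :=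
            ENNReal.div_le_div_right h1 _
        _ = s n := rfl
    -- `c n → (1/ℓ)^d`
    have hc_tend : Tendsto c atTop (𝓝 (ENNReal.ofReal ((1 / ℓ) ^ Fintype.card d))) := by
      have h2 := ENNReal.tendsto_ofReal ((tendsto_floor_div ℓ hℓ).pow (Fintype.card d))
      refine h2.congr' ?_
      filter_upwards [eventually_ge_atTop 1] with n hn
      have hn' : (0 : ℝ) < 2 * n := by positivity
      simp only [hc]
      rw [volume_cube, div_pow, ENNReal.ofReal_div_of_pos (pow_pos hn' _),
        ENNReal.ofReal_pow (Nat.cast_nonneg _), ENNReal.ofReal_natCast, ENNReal.ofReal_pow hn'.le]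
    have hlim : Tendsto (fun n => c n * H) atTop
        (𝓝 (ENNReal.ofReal ((1 / ℓ) ^ Fintype.card d) * H)) :=
      ENNReal.Tendsto.mul_const hc_tend (Or.inl (ENNReal.ofReal_pos.2 (by positivity)).ne')
    have hval : H / volume (box a (fun i => a i + ℓ) : Set (EuclideanSpace ℝ d)) =
        ENNReal.ofReal ((1 / ℓ) ^ Fintype.card d) * H := by
      rw [hvol, one_div, inv_pow, ENNReal.ofReal_inv_of_pos (pow_pos hℓ _), mul_comm,
        div_eq_mul_inv]
    rw [hval, ← hlim.liminf_eq]
    exact liminf_le_liminf (Eventually.of_forall hcs)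
  have h_liminf : S ≤ liminf s atTop :=
    iSup_le fun a => iSup_le fun ℓ => iSup_le fun hℓ => h_low a ℓ hℓ
  have h1 : liminf s atTop ≤ limsup s atTop := liminf_le_limsup
  have hlimsup_eq : limsup s atTop = S := le_antisymm h_limsup (h_liminf.trans h1)
  have hliminf_eq : liminf s atTop = S := le_antisymm (h1.trans h_limsup) h_liminf
  have hspec : specificRelativeEntropy ν π = S := hlimsup_eq
  refine ⟨?_, hspec⟩
  rw [hspec]
  exact tendsto_of_liminf_eq_limsup hliminf_eq hlimsup_eq

end Main

end Literature.MathematicalPhysics.StatisticalMechanics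

end
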